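import Summits.KontsevichZagierPeriods.KontsevichZagierPeriods.Theorems.TerasomaMultiplicationBetaCancellationStubTameFormAux12
import Mathlib.Analysis.Calculus.Deriv.MeanValue
import Literature.NumberTheory.Transcendental.KZExpCalculusProofs

/-!
# `BetaCancellation` (stmt-KontsevichZagierPeriods-13633), line `divisor-slicing-transshipment` — stub `stub_tameForm`, auxiliary file 21: straightening a Newton–Leibniz cell

**The straightening chart of rule (3).** Over an open `ℚ`-semialgebraic base `S ⊆ ℝⁿ` let
`lo < hi` be continuous `ℚ`-semialgebraic functions and `T = {(x, t) | x ∈ S, lo x < t < hi x}` the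
open cell between them; let `F` be `ℚ`-semialgebraic and differentiable on `T`, continuous on each
closed fibre `[lo x, hi x]` and with `∂F/∂t = f > 0` on each open fibre. Then `F` is strictly
increasing on the fibres, and the vertical map `Θ (x, t) = (x, (F (x,t) − F (x, lo x)) / ΔG x)`,
`ΔG x = F (x, hi x) − F (x, lo x) > 0`, is a `ℚ`-semialgebraic injective map on `T` with derivative
of determinant `f / ΔG` (auxiliary file 10) and image EXACTLY `S × (0,1)` (intermediate values).

References: M. Kontsevich, D. Zagier, *Periods* (2001), §1.2 rule (3); crux NOTES c6 (F13).
-/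

noncomputable section

-- `Summit.KontsevichZagierPeriods.KontsevichZagierPeriods.…` is the tree's mandated layout (single-conjunct summit).
set_option linter.dupNamespace false

namespace Summit.KontsevichZagierPeriods.KontsevichZagierPeriods.BetaCancellationDivisorSlicing

open MeasureTheory Set Function Filter
open scoped Topology
open Literature.NumberTheory.Transcendental
open Literature.NumberTheory.Transcendental.KZ
open Literature.ModelTheory.ExponentialFields (IsSemialgebraic isSemialgebraic_univ)

variable {n : ℕ}

/-- **The open cell between two continuous functions over an open base is open.** [folklore] -/
theorem isOpen_cell {S : Set (Fin n → ℝ)} (hSo : IsOpen S) {lo hi : (Fin n → ℝ) → ℝ}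
    (hloc : ContinuousOn lo S) (hhic : ContinuousOn hi S) :
    IsOpen {z : Fin (n + 1) → ℝ | (Fin.init z : Fin n → ℝ) ∈ S ∧ lo (Fin.init z) < z (Fin.last n) ∧
      z (Fin.last n) < hi (Fin.init z)} := by
  rw [isOpen_iff_mem_nhds]
  rintro z ⟨hz, hlo, hhi⟩
  have hinit : Continuous fun z : Fin (n + 1) → ℝ => (Fin.init z : Fin n → ℝ) := continuous_id.finInit
  have h1 : ∀ᶠ z' in 𝓝 z, (Fin.init z' : Fin n → ℝ) ∈ S :=
    hinit.continuousAt.preimage_mem_nhds (hSo.mem_nhds hz)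
  have hloz : ContinuousAt (fun z' : Fin (n + 1) → ℝ => lo (Fin.init z')) z :=
    ((hloc _ hz).continuousAt (hSo.mem_nhds hz)).comp hinit.continuousAt
  have hhiz : ContinuousAt (fun z' : Fin (n + 1) → ℝ => hi (Fin.init z')) z :=
    ((hhic _ hz).continuousAt (hSo.mem_nhds hz)).comp hinit.continuousAt
  have hlast : ContinuousAt (fun z' : Fin (n + 1) → ℝ => z' (Fin.last n)) z := (continuous_apply _).continuousAt
  have h2 : ∀ᶠ z' in 𝓝 z, lo (Fin.init z') < z' (Fin.last n) := by
    have hc : ContinuousAt (fun z' : Fin (n + 1) → ℝ => z' (Fin.last n) - lo (Fin.init z')) z := hlast.sub hloz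
    have h0 : (0 : ℝ) < z (Fin.last n) - lo (Fin.init z) := by linarith
    exact (hc.eventually (lt_mem_nhds h0)).mono fun z' h => by linarith
  have h3 : ∀ᶠ z' in 𝓝 z, z' (Fin.last n) < hi (Fin.init z') := by
    have hc : ContinuousAt (fun z' : Fin (n + 1) → ℝ => hi (Fin.init z') - z' (Fin.last n)) z := hhiz.sub hlast
    have h0 : (0 : ℝ) < hi (Fin.init z) - z (Fin.last n) := by linarith
    exact (hc.eventually (lt_mem_nhds h0)).mono fun z' h => by linarith
  filter_upwards [h1, h2, h3] with z' h1 h2 h3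
  exact ⟨h1, h2, h3⟩

/-- **Strict monotonicity along the fibres** from `∂F/∂t = f > 0`. [folklore] -/
theorem strictMonoOn_fibre {lo hi : ℝ} {φ : ℝ → ℝ} {f : ℝ → ℝ} (hc : ContinuousOn φ (Icc lo hi))
    (hd : ∀ t ∈ Ioo lo hi, HasDerivAt φ (f t) t) (hpos : ∀ t ∈ Ioo lo hi, 0 < f t) :
    StrictMonoOn φ (Icc lo hi) := by
  refine strictMonoOn_of_deriv_pos (convex_Icc _ _) hc fun t ht => ?_
  rw [interior_Icc] at ht
  rw [(hd t ht).deriv]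
  exact hpos t ht

/-- **The straightening piece.** [cite: KontsevichZagier2001, §1.2 rule (3)] -/
theorem exists_straightenPiece {S : Set (Fin n → ℝ)} (hSo : IsOpen S) (hS : IsSemialgebraic ℚ S)
    {lo hi : (Fin n → ℝ) → ℝ} (hlo : IsSemialgebraicFunOn ℚ S lo) (hhi : IsSemialgebraicFunOn ℚ S hi)
    (hloc : ContinuousOn lo S) (hhic : ContinuousOn hi S) (hlh : ∀ x ∈ S, lo x < hi x)
    {F f : (Fin (n + 1) → ℝ) → ℝ}
    (hFs : IsSemialgebraicFunOn ℚ {z : Fin (n + 1) → ℝ | (Fin.init z : Fin n → ℝ) ∈ S ∧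
      lo (Fin.init z) < z (Fin.last n) ∧ z (Fin.last n) < hi (Fin.init z)} F)
    (hFd : ∀ z ∈ {z : Fin (n + 1) → ℝ | (Fin.init z : Fin n → ℝ) ∈ S ∧
      lo (Fin.init z) < z (Fin.last n) ∧ z (Fin.last n) < hi (Fin.init z)}, DifferentiableAt ℝ F z)
    (hFc : ∀ x ∈ S, ContinuousOn (fun t => F (Fin.snoc x t)) (Icc (lo x) (hi x)))
    (hFt : ∀ x ∈ S, ∀ t ∈ Ioo (lo x) (hi x), HasDerivAt (fun s => F (Fin.snoc x s)) (f (Fin.snoc x t)) t)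
    (hpos : ∀ x ∈ S, ∀ t ∈ Ioo (lo x) (hi x), 0 < f (Fin.snoc x t))
    (hGlo : IsSemialgebraicFunOn ℚ S (fun x => F (Fin.snoc x (lo x))))
    (hGhi : IsSemialgebraicFunOn ℚ S (fun x => F (Fin.snoc x (hi x))))
    (hGlod : DifferentiableOn ℝ (fun x => F (Fin.snoc x (lo x))) S)
    (hGhid : DifferentiableOn ℝ (fun x => F (Fin.snoc x (hi x))) S) :
    ∃ Ψ' : (Fin (n + 1) → ℝ) → ((Fin (n + 1) → ℝ) →L[ℝ] (Fin (n + 1) → ℝ)),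
      (∀ x ∈ S, 0 < F (Fin.snoc x (hi x)) - F (Fin.snoc x (lo x))) ∧
      IsSemialgebraicMapOn ℚ {z : Fin (n + 1) → ℝ | (Fin.init z : Fin n → ℝ) ∈ S ∧
        lo (Fin.init z) < z (Fin.last n) ∧ z (Fin.last n) < hi (Fin.init z)}
        (fun w => Fin.snoc (Fin.init w) ((F w - F (Fin.snoc (Fin.init w) (lo (Fin.init w)))) /
          (F (Fin.snoc (Fin.init w) (hi (Fin.init w))) - F (Fin.snoc (Fin.init w) (lo (Fin.init w)))))) ∧
      InjOn (fun w : Fin (n + 1) → ℝ => (Fin.snoc (Fin.init w) ((F w - F (Fin.snoc (Fin.init w) (lo (Fin.init w)))) /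
          (F (Fin.snoc (Fin.init w) (hi (Fin.init w))) - F (Fin.snoc (Fin.init w) (lo (Fin.init w))))) :
            Fin (n + 1) → ℝ))
        {z : Fin (n + 1) → ℝ | (Fin.init z : Fin n → ℝ) ∈ S ∧ lo (Fin.init z) < z (Fin.last n) ∧
          z (Fin.last n) < hi (Fin.init z)} ∧
      (∀ z ∈ {z : Fin (n + 1) → ℝ | (Fin.init z : Fin n → ℝ) ∈ S ∧ lo (Fin.init z) < z (Fin.last n) ∧
          z (Fin.last n) < hi (Fin.init z)},
        HasFDerivWithinAt (fun w : Fin (n + 1) → ℝ => (Fin.snoc (Fin.init w)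
          ((F w - F (Fin.snoc (Fin.init w) (lo (Fin.init w)))) /
          (F (Fin.snoc (Fin.init w) (hi (Fin.init w))) - F (Fin.snoc (Fin.init w) (lo (Fin.init w))))) :
            Fin (n + 1) → ℝ)) (Ψ' z)
          {z : Fin (n + 1) → ℝ | (Fin.init z : Fin n → ℝ) ∈ S ∧ lo (Fin.init z) < z (Fin.last n) ∧
            z (Fin.last n) < hi (Fin.init z)} z ∧
        (Ψ' z).det = f z / (F (Fin.snoc (Fin.init z) (hi (Fin.init z))) - F (Fin.snoc (Fin.init z) (lo (Fin.init z))))) ∧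
      (fun w : Fin (n + 1) → ℝ => (Fin.snoc (Fin.init w) ((F w - F (Fin.snoc (Fin.init w) (lo (Fin.init w)))) /
          (F (Fin.snoc (Fin.init w) (hi (Fin.init w))) - F (Fin.snoc (Fin.init w) (lo (Fin.init w))))) :
            Fin (n + 1) → ℝ)) ''
        {z : Fin (n + 1) → ℝ | (Fin.init z : Fin n → ℝ) ∈ S ∧ lo (Fin.init z) < z (Fin.last n) ∧
          z (Fin.last n) < hi (Fin.init z)} =
        {z : Fin (n + 1) → ℝ | (Fin.init z : Fin n → ℝ) ∈ S ∧ z (Fin.last n) ∈ Ioo (0 : ℝ) 1} := by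
  set T := {z : Fin (n + 1) → ℝ | (Fin.init z : Fin n → ℝ) ∈ S ∧ lo (Fin.init z) < z (Fin.last n) ∧
    z (Fin.last n) < hi (Fin.init z)} with hT_def
  set Glo : (Fin n → ℝ) → ℝ := fun x => F (Fin.snoc x (lo x)) with hGlo_def
  set Ghi : (Fin n → ℝ) → ℝ := fun x => F (Fin.snoc x (hi x)) with hGhi_def
  set ΔG : (Fin n → ℝ) → ℝ := fun x => Ghi x - Glo x with hΔG_def
  -- fibrewise strict monotonicity
  have hmono : ∀ x ∈ S, StrictMonoOn (fun t => F (Fin.snoc x t)) (Icc (lo x) (hi x)) := fun x hx =>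
    strictMonoOn_fibre (hFc x hx) (hFt x hx) (hpos x hx)
  have hΔpos : ∀ x ∈ S, 0 < ΔG x := fun x hx => by
    have := hmono x hx (left_mem_Icc.mpr (hlh x hx).le) (right_mem_Icc.mpr (hlh x hx).le) (hlh x hx)
    simp only [hΔG_def, hGhi_def, hGlo_def]
    linarith
  have hΔne : ∀ x ∈ S, ΔG x ≠ 0 := fun x hx => (hΔpos x hx).ne'
  have hTo : IsOpen T := isOpen_cell hSo hloc hhic
  have hTcyl : T ⊆ {z : Fin (n + 1) → ℝ | (Fin.init z : Fin n → ℝ) ∈ S} := fun z hz => hz.1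
  have hcyl : IsSemialgebraic ℚ {z : Fin (n + 1) → ℝ | (Fin.init z : Fin n → ℝ) ∈ S} := hS.preimage_comp Fin.castSucc
  have hT : IsSemialgebraic ℚ T := by
    have hloi : IsSemialgebraicFunOn ℚ {z : Fin (n + 1) → ℝ | (Fin.init z : Fin n → ℝ) ∈ S} (fun z => lo (Fin.init z)) :=
      hlo.comp_init_mono hcyl fun _ h => h
    have hhii : IsSemialgebraicFunOn ℚ {z : Fin (n + 1) → ℝ | (Fin.init z : Fin n → ℝ) ∈ S} (fun z => hi (Fin.init z)) :=
      hhi.comp_init_mono hcyl fun _ h => h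
    have hli := isSemialgebraicFunOn_apply hcyl (Fin.last n)
    convert (isSemialgebraic_sep_lt' hloi hli).inter (isSemialgebraic_sep_lt' hli hhii) using 1
    ext z; simp only [hT_def, mem_setOf_eq, mem_inter_iff]; tauto
  -- the height function of the chart
  set H : (Fin (n + 1) → ℝ) → ℝ := fun w => (F w - Glo (Fin.init w)) / ΔG (Fin.init w) with hH_def
  have hHs : IsSemialgebraicFunOn ℚ T H := by
    have h1 : IsSemialgebraicFunOn ℚ T (fun w => Glo (Fin.init w)) := hGlo.comp_init_mono hT hTcyl
    have h2 : IsSemialgebraicFunOn ℚ T (fun w => ΔG (Fin.init w)) := (IsSemialgebraicFunOn.sub_holds hGhi hGlo).comp_init_mono hT hTcyl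
    exact (IsSemialgebraicFunOn.sub_holds hFs h1).div h2 fun w hw => hΔne _ hw.1
  have hHd : ∀ z ∈ T, HasFDerivAt H (fderiv ℝ H z) z := by
    intro z hz
    have hx : (Fin.init z : Fin n → ℝ) ∈ S := hz.1
    have hinit : DifferentiableAt ℝ (fun w : Fin (n + 1) → ℝ => (Fin.init w : Fin n → ℝ)) z :=
      (ContinuousLinearMap.pi fun i : Fin n => ContinuousLinearMap.proj (R := ℝ)
        (φ := fun _ : Fin (n + 1) => ℝ) (Fin.castSucc i)).differentiableAt
    have h1 : DifferentiableAt ℝ (fun w : Fin (n + 1) → ℝ => Glo (Fin.init w)) z :=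
      ((hGlod _ hx).differentiableAt (hSo.mem_nhds hx)).comp z hinit
    have h2 : DifferentiableAt ℝ (fun w : Fin (n + 1) → ℝ => Ghi (Fin.init w)) z :=
      ((hGhid _ hx).differentiableAt (hSo.mem_nhds hx)).comp z hinit
    have h3 : DifferentiableAt ℝ (fun w : Fin (n + 1) → ℝ => ΔG (Fin.init w)) z := h2.sub h1
    have : DifferentiableAt ℝ H z := by
      simp only [hH_def, div_eq_mul_inv]
      exact ((hFd z hz).sub h1).mul (h3.inv (hΔne _ hx))
    exact this.hasFDerivAt
  have hinj : ∀ z ∈ T, ∀ z' ∈ T, Fin.init z = Fin.init z' → H z = H z' → z = z' := by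
    intro z hz z' hz' hii hH
    have hx' : (Fin.init z' : Fin n → ℝ) ∈ S := hz'.1
    simp only [hH_def, hii] at hH
    rw [div_left_inj' (hΔne _ hx'), sub_left_inj] at hH
    have ht : z (Fin.last n) ∈ Icc (lo (Fin.init z')) (hi (Fin.init z')) := by
      rw [← hii]; exact ⟨hz.2.1.le, hz.2.2.le⟩
    have ht' : z' (Fin.last n) ∈ Icc (lo (Fin.init z')) (hi (Fin.init z')) := ⟨hz'.2.1.le, hz'.2.2.le⟩
    have heq : F (Fin.snoc (Fin.init z') (z (Fin.last n))) = F (Fin.snoc (Fin.init z') (z' (Fin.last n))) := by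
      rw [Fin.snoc_init_self, ← hii, Fin.snoc_init_self]; exact hH
    have := (hmono _ hx').injOn ht ht' heq
    rw [← Fin.snoc_init_self z, ← Fin.snoc_init_self z', hii, this]
  obtain ⟨Ψ', hsa, hinjP, hder, hdet⟩ := exists_verticalPiece hTo subset_rfl hT hHs hHd hinj
  -- the determinant along the fibre
  have hdet' : ∀ z ∈ T, (fderiv ℝ H z) (Pi.single (Fin.last n) 1) = f z / ΔG (Fin.init z) := by
    intro z hz
    have hx : (Fin.init z : Fin n → ℝ) ∈ S := hz.1
    have ht : z (Fin.last n) ∈ Ioo (lo (Fin.init z)) (hi (Fin.init z)) := ⟨hz.2.1, hz.2.2⟩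
    have hz' : (Fin.snoc (Fin.init z) (z (Fin.last n)) : Fin (n + 1) → ℝ) = z := Fin.snoc_init_self z
    have h1 : HasDerivAt (H ∘ fun t : ℝ => (Fin.snoc (Fin.init z) t : Fin (n + 1) → ℝ))
        ((fderiv ℝ H z) (Pi.single (Fin.last n) 1)) (z (Fin.last n)) := by
      have hH0 : HasFDerivAt H (fderiv ℝ H z) (Fin.snoc (Fin.init z) (z (Fin.last n))) := by
        rw [hz']; exact hHd z hz
      exact hH0.comp_hasDerivAt (z (Fin.last n)) (KZexp.hasDerivAt_snoc (Fin.init z) (z (Fin.last n)))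
    have h2 : HasDerivAt (H ∘ fun t : ℝ => (Fin.snoc (Fin.init z) t : Fin (n + 1) → ℝ))
        (f (Fin.snoc (Fin.init z) (z (Fin.last n))) / ΔG (Fin.init z)) (z (Fin.last n)) := by
      have := ((hFt _ hx _ ht).sub_const (Glo (Fin.init z))).div_const (ΔG (Fin.init z))
      refine this.congr_of_eventuallyEq (Eventually.of_forall fun s => ?_)
      simp [hH_def]
    rw [hz'] at h2
    exact h1.unique h2
  -- the image
  have himage : (fun w : Fin (n + 1) → ℝ => (Fin.snoc (Fin.init w) (H w) : Fin (n + 1) → ℝ)) '' T =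
      {z : Fin (n + 1) → ℝ | (Fin.init z : Fin n → ℝ) ∈ S ∧ z (Fin.last n) ∈ Ioo (0 : ℝ) 1} := by
    ext w
    simp only [mem_image, mem_setOf_eq, mem_Ioo]
    constructor
    · rintro ⟨z, hz, rfl⟩
      have hx : (Fin.init z : Fin n → ℝ) ∈ S := hz.1
      refine ⟨by simpa using hx, ?_⟩
      simp only [Fin.snoc_last, hH_def]
      have hlt1 := hmono _ hx (left_mem_Icc.mpr (hlh _ hx).le) ⟨hz.2.1.le, hz.2.2.le⟩ hz.2.1
      have hlt2 := hmono _ hx ⟨hz.2.1.le, hz.2.2.le⟩ (right_mem_Icc.mpr (hlh _ hx).le) hz.2.2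
      simp only [Fin.snoc_init_self] at hlt1 hlt2
      have hΔ := hΔpos _ hx
      simp only [hΔG_def, hGhi_def, hGlo_def] at hΔ ⊢
      constructor
      · exact div_pos (by linarith) hΔ
      · rw [div_lt_one hΔ]; linarith
    · rintro ⟨hw, h0, h1⟩
      set x : Fin n → ℝ := Fin.init w
      have hΔ := hΔpos _ hw
      set y := Glo x + w (Fin.last n) * ΔG x with hy
      have hyI : y ∈ Ioo (F (Fin.snoc x (lo x))) (F (Fin.snoc x (hi x))) := by
        simp only [hy, hΔG_def, hGhi_def, hGlo_def, mem_Ioo]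
        constructor <;> nlinarith
      obtain ⟨t, ht, hty⟩ := intermediate_value_Ioo (hlh _ hw).le (hFc _ hw) hyI
      refine ⟨Fin.snoc x t, ⟨by simpa using hw, by simpa using ht.1, by simpa using ht.2⟩, ?_⟩
      have : H (Fin.snoc x t) = w (Fin.last n) := by
        simp only [hH_def, Fin.init_snoc, hty, hy]
        field_simp
        ring
      rw [Fin.init_snoc, this, Fin.snoc_init_self]
  exact ⟨Ψ', hΔpos, hsa, hinjP, fun z hz => ⟨hder z hz, by rw [hdet z hz, hdet' z hz]⟩, himage⟩

/-! ### Headline -/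

/-- Registered helper goal of the stub `stub_tameForm`: strict monotonicity along a fibre from a
positive derivative. [folklore] -/
theorem tameForm_aux_fibreMono : ∀ {lo hi : ℝ} {φ f : ℝ → ℝ}, ContinuousOn φ (Set.Icc lo hi) → (∀ t ∈ Set.Ioo lo hi, HasDerivAt φ (f t) t) → (∀ t ∈ Set.Ioo lo hi, 0 < f t) → StrictMonoOn φ (Set.Icc lo hi) :=
  fun hc hd hpos => strictMonoOn_fibre hc hd hpos

end Summit.KontsevichZagierPeriods.KontsevichZagierPeriods.BetaCancellationDivisorSlicing

end
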